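import Literature.AlgebraicGeometry.Frobenioids.BiratFrobeniusCompactCriterion
import Literature.AlgebraicGeometry.Frobenioids.GeometricFrobenioidStandard
import Literature.AlgebraicGeometry.Frobenioids.GeometricFrobenioidRational
import Literature.AlgebraicGeometry.Frobenioids.ModelFrobenioidBiratNormalized
import Literature.AlgebraicGeometry.Frobenioids.Prop55SubRatStdSlot
import HarnessLib

/-!
# Frobenioids I, Theorem 6.2 (iii): a Frobenius-compact object of `(C_{K̃/K}^un-tr)^birat`, and Thm. 6.2 (iii)
# HOLDS at THE birationalization and THE parameters of Def. 4.5 (iii) — PROOFS (sub-DAG row T62iii/L10 closed)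

Mochizuki, *The geometry of Frobenioids I: the general theory*, Kyushu J. Math. **62** (2008) 293–400, Thm. 6.2
(iii), kurims p. 111, proof p. 112 ll. 4–15: "Now suppose that for every finite extension `L ⊆ K̃` of `K`, and
every `D ∈ D_L`, it holds that `D` lies in the support of the image in `Φ(L)^gp` of an element of `B(L)`. … Now I
claim that every object of `(C^un-tr)^birat` is Frobenius-compact. … hence that `λ = 1`. This completes the proof
of the claim, and hence of the fact that `C` is of rationally standard type." [cite: MochizukiFrdI2008, Thm. 6.2 (iii) p.112]
Def. 4.5 (iii)(b) p. 86 [cite: MochizukiFrdI2008, Def. 4.5 (iii) p.86].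

PROOF-ONLY (theorems, no `def`; cell abc-iut, seat abc-iut-L6-t10 gen 3, holder of the [FrdI] §6 sub-DAG).
Seat abc-iut-L6-t10 gen 2 reduced the typed Thm. 6.2 (iii) for THE constructed `C_{K̃/K}` (every
`GeometricDivisorData`, v4) at THE birationalization and THE parameters `PreFrobenioid.rsParams hF PrimarySupp`
(`Thm62iii_iff_inputs`, `isRational_geom`, `isOfStandardType_geom`; cf. its `GeometricFrobenioidRationallyStandard.lean`)
UP TO: the printed zero-or-pole hypothesis must yield a Frobenius-compact object of `(C^un-tr)^birat`.  This file
(self-contained over the BUILT parents) supplies that by the generic criterion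
`PreFrobenioid.Birat.untr_isFrobeniusCompact_of_invariant` (gen 3) at the object `(Spec K, 0)` over the BOTTOM
field, whose base endomorphism monoid is trivial (so Def. 1.2 (iv)'s automorphisms act on divisors through
`id`), with `d₀ :=` the divisor of a rational function `f ∈ B(K)` having a zero or pole at a prime divisor of
`V_K` (the printed hypothesis; `D_K ≠ ∅` because some `D_L ≠ ∅`, v3 field `primeDiv_nonempty`, and prime divisors
descend along `over`):
* `FinSubextCat.hom_bot_eq_id` — `End_D(Spec K) = {id}` in `D = B(Gal(K̃/K))⁰` (the arrow `Spec L → Spec K` being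
  `⟨IntermediateField.inclusion bot_le⟩`);
* `GeometricDivisorData.divPhi_pow_ne_one` — a rational divisor with a nonzero coefficient is NON-TORSION in
  `Φ(L)^gp ⊆ ℤ[D_L]` (`phiGpHom` injective);
* `GeometricDivisorData.exists_primeDiv_bot` — `D_K ≠ ∅`;
* `geomFrobenioid_untrBirat_isFrobeniusCompact_bot` / `geomFrobenioid_exists_isFrobeniusCompact` — under the
  printed hypothesis, `[(Spec K, 0)]^birat ∈ (C^un-tr)^birat` is Frobenius-compact; Def. 4.5 (iii)(b);
* `geomFrobenioid_isOfRationallyStandardType_rsParams` — `C_{K̃/K}` IS of rationally standard type at THE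
  parameters under the printed hypothesis (the four clauses of Def. 4.5 (iii) by name: gen 2's birational/rational/standard theorems + (b));
* **`Thm62iii_rsParams : Thm62iii (geomModelFrobenioid Γ) (THE biratData) (THE rsParams)`** — seat abc-iut-L1-t3's
  typed Thm. 6.2 (iii) CLOSED at THE constructions for EVERY `GeometricDivisorData`, no hypothesis left
  (gen 2's reduction `Thm62iii_iff_inputs`, `GeometricFrobenioidStandard.lean`).
Print's stronger "EVERY object of `(C^un-tr)^birat` is Frobenius-compact" (argued there via the order of the
highest zero or pole, data row T62iii/L09 `frobCompact_data`) is `geomFrobenioid_untrBirat_isFrobeniusCompact` /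
`_all`: at an object over `Spec L` take `d₀ := σ₀^* div(f) = div(f|_L)`, invariant because `Hom_D(Spec L, Spec K)`
is a singleton (`FinSubextCat.subsingleton_hom_bot`).

Standard axioms only. Nothing here bears on [IUTchIII] Cor. 3.12 or asserts anything about abc.
-/

noncomputable section

namespace Literature.AlgebraicGeometry.Frobenioids

open CategoryTheory Opposite Function

/-! ### `End_D(Spec K)` is trivial -/

namespace FinSubextCat

variable {K : Type} [Field K] {Kt : Type} [Field Kt] [Algebra K Kt]

/-- In `D = B(G)⁰` (finite subextensions of `K̃/K`), the object `Spec K` (the bottom field) has only the identity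
endomorphism: a `K`-algebra endomorphism of `K` is the identity. [cite: MochizukiFrdI2008, Ex. 6.1 p.109] -/
theorem hom_bot_eq_id (σ : (⟨⊥⟩ : FinSubextCat K Kt) ⟶ ⟨⊥⟩) : σ = 𝟙 _ := by
  refine FinSubextCat.hom_ext (AlgHom.ext fun x => ?_)
  obtain ⟨c, hc⟩ := IntermediateField.mem_bot.mp x.2
  have hx : x = algebraMap K (⊥ : IntermediateField K Kt) c := Subtype.ext hc.symm
  rw [hx, AlgHom.commutes]
  rfl

end FinSubextCat

/-! ### Non-torsion rational divisors; `D_K ≠ ∅` -/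

namespace GeometricDivisorData

variable {K : Type} [Field K] {Kt : Type} [Field Kt] [Algebra K Kt] (Γ : GeometricDivisorData K Kt)

/-- A rational divisor `div(f)` with a nonzero coefficient at some prime divisor is a NON-TORSION element of
`Φ(L)^gp` (read in `ℤ[D_L]` through the injection `phiGpHom`). [cite: MochizukiFrdI2008, Ex. 6.1 p.109] -/
theorem divPhi_pow_ne_one (X : FinSubextCat K Kt) (f : Γ.B X) (P : Γ.primeDiv X)
    (hP : (Multiplicative.toAdd (Γ.div X f)) P ≠ 0) (N : ℕ) (hN : 0 < N) : Γ.divPhi X f ^ N ≠ 1 := by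
  intro h
  have h' := congrArg (Γ.phiGpHom X) h
  rw [map_pow, phiGpHom_divPhi, map_one, ← ofAdd_toAdd (Γ.div X f), ← ofAdd_nsmul, ofAdd_eq_one,
    smul_eq_zero] at h'
  rcases h' with h' | h'
  · exact (Nat.pos_iff_ne_zero.mp hN) h'
  · exact hP (by rw [h', Finsupp.zero_apply])

/-- **`D_K ≠ ∅`**: the bottom object `Spec K` has a prime divisor (some `D_L` is nonempty — v3 field
`primeDiv_nonempty`, Thm. 6.2's "`D_K ≠ ∅`" as typed — and prime divisors descend along `over` applied to the arrow `Spec L → Spec K`).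
[cite: MochizukiFrdI2008, Thm. 6.2 p.110] -/
theorem exists_primeDiv_bot : Nonempty (Γ.primeDiv ⟨⊥⟩) := by
  obtain ⟨X, ⟨Q⟩⟩ := Γ.primeDiv_nonempty
  exact ⟨Γ.over (⟨IntermediateField.inclusion bot_le⟩ : X ⟶ ⟨⊥⟩) Q⟩

end GeometricDivisorData

/-! ### Def. 4.5 (iii)(b) for `C_{K̃/K}` and Theorem 6.2 (iii) at THE parameters -/

section Geom

variable {K : Type} [Field K] {Kt : Type} [Field Kt] [Algebra K Kt] [IsGalois K Kt] (Γ : GeometricDivisorData K Kt)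

/-- **Under the hypothesis of Thm. 6.2 (iii) (every prime divisor is a zero or a pole of a rational function), the
object `[(Spec K, 0)]^birat` of `(C_{K̃/K}^un-tr)^birat` is Frobenius-compact**: the generic criterion at
`d₀ = div(f)`, `f ∈ B(K)` with a zero or pole at some `D ∈ D_K` (non-torsion), invariant because
`End_D(Spec K) = {id}`. [cite: MochizukiFrdI2008, Thm. 6.2 (iii) p.112] -/
theorem geomFrobenioid_untrBirat_isFrobeniusCompact_bot
    (hsupport : ∀ (X : FinSubextCat K Kt) (P : Γ.primeDiv X), ∃ f : Γ.B X, (Multiplicative.toAdd (Γ.div X f)) P ≠ 0) :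
    (PreFrobenioid.rsParams (geomFrobenioid_isFrobenioid Γ) fun a 𝔭 => PrimarySupp a 𝔭).BU.ops.IsFrobeniusCompact
      ((PreFrobenioid.rsParams (geomFrobenioid_isFrobenioid Γ) fun a 𝔭 => PrimarySupp a 𝔭).BU.toBirat.obj
        ((geomFrobenioidOps Γ).toUntr.obj
          ⟨(⟨⟨⊥⟩, 1⟩ : geomFrobenioid Γ), (isOfIsotropicType_geom Γ).obj _⟩)) := by
  obtain ⟨P⟩ := Γ.exists_primeDiv_bot
  obtain ⟨f, hf⟩ := hsupport ⟨⊥⟩ P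
  refine PreFrobenioid.Birat.untr_isFrobeniusCompact_of_invariant (geomFrobenioid_isFrobenioid Γ) _
    (divB (geomDivisorFunctor Γ) (geomUnitsFunctor Γ) (geomDivNatTrans Γ) (op ⟨⊥⟩) f) ?_ ?_ ?_
  · exact (ModelFrobenioid.mem_biratSubgroup_iff_exists_divB (geomUnitsFunctor_isGroupLike Γ)
      (fun X => Γ.isDivisorial_phi X) (geomFrobenioid_isFrobenioid Γ) (⟨⟨⊥⟩, 1⟩ : geomFrobenioid Γ) _).mpr
      ⟨f, rfl⟩
  · exact Γ.divPhi_pow_ne_one ⟨⊥⟩ f P hf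
  · intro g
    have hg : PreFrobenioid.Birat.gpBase g.inv = 𝟙 _ := FinSubextCat.hom_bot_eq_id _
    rw [hg]
    exact pullGp_id (Φ := geomDivisorFunctor Γ) _ _

/-- **Def. 4.5 (iii)(b) for `C_{K̃/K}` at THE `(C^un-tr)^birat`**, under the printed hypothesis of Thm. 6.2 (iii) —
the input left open by gen 2's `Thm62iii_rsParams_iff`. [cite: MochizukiFrdI2008, Thm. 6.2 (iii) p.112] -/
theorem geomFrobenioid_exists_isFrobeniusCompact
    (hsupport : ∀ (X : FinSubextCat K Kt) (P : Γ.primeDiv X), ∃ f : Γ.B X, (Multiplicative.toAdd (Γ.div X f)) P ≠ 0) :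
    ∃ X : (PreFrobenioid.rsParams (geomFrobenioid_isFrobenioid Γ) fun a 𝔭 => PrimarySupp a 𝔭).BU.Birat,
      (PreFrobenioid.rsParams (geomFrobenioid_isFrobenioid Γ) fun a 𝔭 => PrimarySupp a 𝔭).BU.ops.IsFrobeniusCompact
        X :=
  ⟨_, geomFrobenioid_untrBirat_isFrobeniusCompact_bot Γ hsupport⟩

/-- **`C_{K̃/K}` IS of rationally standard type at THE parameters** (Def. 4.5 (iii)) under the printed zero-or-pole
hypothesis — no further input. [cite: MochizukiFrdI2008, Thm. 6.2 (iii) p.112] -/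
theorem geomFrobenioid_isOfRationallyStandardType_rsParams
    (hsupport : ∀ (X : FinSubextCat K Kt) (P : Γ.primeDiv X), ∃ f : Γ.B X, (Multiplicative.toAdd (Γ.div X f)) P ≠ 0) :
    (geomFrobenioidOps Γ).IsOfRationallyStandardType
      (PreFrobenioid.rsParams (geomFrobenioid_isFrobenioid Γ) fun a 𝔭 => PrimarySupp a 𝔭) :=
  ⟨ModelFrobenioid.isOfBiratFrobeniusNormalizedType_of_isDivisorial (geomFrobenioid_isFrobenioid Γ)
      (PreFrobenioid.hasBiratSquares_of_isFrobenioid (geomFrobenioid_isFrobenioid Γ))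
      (fun X => Γ.isDivisorial_phi X) (geomUnitsFunctor_isGroupLike Γ),
    fun A => isRational_geom Γ Γ.sub_mem hsupport (geomFrobenioid_isFrobenioid Γ)
      (PreFrobenioid.hasBiratSquares_of_isFrobenioid (geomFrobenioid_isFrobenioid Γ)) _ (fun _ _ _ => Iff.rfl) A,
    isOfStandardType_geom Γ, geomFrobenioid_exists_isFrobeniusCompact Γ hsupport⟩

/-- **[FrdI] Theorem 6.2 (iii), AS TYPED by seat abc-iut-L1-t3 (`Thm62iii`), CLOSED at THE constructions for EVERY
`GeometricDivisorData`**: THE geometric model Frobenioid `C_{K̃/K}` (`geomModelFrobenioid Γ`) "[is] of isotropic,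
standard and birationally Frobenius-normalized type, but not of group-like type; and if every `D ∈ D_L` lies in the
support of the divisor of some element of `B(L)`, then `C` is of rationally standard type" — the birationalization
read as THE one and "rationally standard" at THE parameters of Def. 4.5 (iii) (`PreFrobenioid.rsParams`: THE
`C^birat`, the support of Def. 2.4 (i)(d) on primary elements, THE `C^un-tr` and its birationalization).  No free
parameter, no hypothesis. [cite: MochizukiFrdI2008, Thm. 6.2 (iii) p.111] -/
theorem Thm62iii_rsParams :
    Thm62iii (geomModelFrobenioid Γ)
      (PreFrobenioid.biratData (geomFrobenioid_isFrobenioid Γ)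
        (PreFrobenioid.hasBiratSquares_of_isFrobenioid (geomFrobenioid_isFrobenioid Γ)))
      (PreFrobenioid.rsParams (geomFrobenioid_isFrobenioid Γ) fun a 𝔭 => PrimarySupp a 𝔭) :=
  (Thm62iii_iff_inputs Γ _ _).mpr
    ⟨ModelFrobenioid.isOfBiratFrobeniusNormalizedType_of_isDivisorial (geomFrobenioid_isFrobenioid Γ)
        (PreFrobenioid.hasBiratSquares_of_isFrobenioid (geomFrobenioid_isFrobenioid Γ))
        (fun X => Γ.isDivisorial_phi X) (geomUnitsFunctor_isGroupLike Γ),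
      fun hsupport => geomFrobenioid_isOfRationallyStandardType_rsParams Γ hsupport⟩

end Geom

/-! ### Every object of `(C_{K̃/K}^un-tr)^birat` (appended) -/

namespace FinSubextCat

variable {K : Type} [Field K] {Kt : Type} [Field Kt] [Algebra K Kt]

/-- More generally `Hom_D(Spec L, Spec K)` is a singleton for every object `Spec L` of `D = B(G)⁰`: a
`K`-algebra homomorphism out of `K` is determined. [cite: MochizukiFrdI2008, Ex. 6.1 p.109] -/
theorem subsingleton_hom_bot (X : FinSubextCat K Kt) : Subsingleton (X ⟶ (⟨⊥⟩ : FinSubextCat K Kt)) :=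
  ⟨fun σ τ => FinSubextCat.hom_ext (AlgHom.ext fun x => by
    obtain ⟨c, hc⟩ := IntermediateField.mem_bot.mp x.2
    have hx : x = algebraMap K (⊥ : IntermediateField K Kt) c := Subtype.ext hc.symm
    rw [hx, AlgHom.commutes, AlgHom.commutes])⟩

end FinSubextCat

section GeomAll

variable {K : Type} [Field K] {Kt : Type} [Field Kt] [Algebra K Kt] [IsGalois K Kt] (Γ : GeometricDivisorData K Kt)

/-- **"every object of `(C^un-tr)^birat` is Frobenius-compact"** (Thm. 6.2 (iii) proof, p. 112 l. 8–9), for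
the image `[A]^birat` of EVERY object `A` of `C_{K̃/K}` (over any `Spec L`), under the printed zero-or-pole
hypothesis: the generic criterion at `d₀ := div(f|_L)`, the pull-back to `L` of the divisor of a rational function
`f ∈ B(K)` with a zero or pole at some `D ∈ D_K` — NON-TORSION (`(σ₀^* div f)_Q = e_Q · (div f)_{D}` with
`e_Q ≥ 1` for `Q` over `D`) and INVARIANT under the base map `τ` of every automorphism of `[A]^birat` because
`τ^* σ₀^* = (σ₀ ∘ τ)^* = σ₀^*` (`Hom_D(Spec L, Spec K)` is a singleton).  (Print argues through "the order of
the zero or pole of highest order", i.e. the data row T62iii/L09 `frobCompact_data`; the invariant divisor gives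
the same conclusion directly.) [cite: MochizukiFrdI2008, Thm. 6.2 (iii) p.112] -/
theorem geomFrobenioid_untrBirat_isFrobeniusCompact
    (hsupport : ∀ (X : FinSubextCat K Kt) (P : Γ.primeDiv X), ∃ f : Γ.B X, (Multiplicative.toAdd (Γ.div X f)) P ≠ 0)
    (A : geomFrobenioid Γ) :
    (PreFrobenioid.rsParams (geomFrobenioid_isFrobenioid Γ) fun a 𝔭 => PrimarySupp a 𝔭).BU.ops.IsFrobeniusCompact
      ((PreFrobenioid.rsParams (geomFrobenioid_isFrobenioid Γ) fun a 𝔭 => PrimarySupp a 𝔭).BU.toBirat.obj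
        ((geomFrobenioidOps Γ).toUntr.obj ⟨A, (isOfIsotropicType_geom Γ).obj A⟩)) := by
  obtain ⟨P⟩ := Γ.exists_primeDiv_bot
  obtain ⟨f, hf⟩ := hsupport ⟨⊥⟩ P
  let σ₀ : A.base ⟶ (⟨⊥⟩ : FinSubextCat K Kt) := ⟨IntermediateField.inclusion bot_le⟩
  obtain ⟨Q, hQ⟩ := Γ.over_surjective σ₀ P
  have hfQ : Multiplicative.toAdd (Γ.div A.base (Γ.mapB σ₀ f)) Q ≠ 0 := by
    rw [Γ.div_mapB, Γ.pull_apply, hQ]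
    exact mul_ne_zero (Int.natCast_ne_zero.mpr (Γ.ram_pos σ₀ Q).ne') hf
  haveI := FinSubextCat.subsingleton_hom_bot A.base
  have hd : pullGp (geomDivisorFunctor Γ) σ₀
        (divB (geomDivisorFunctor Γ) (geomUnitsFunctor Γ) (geomDivNatTrans Γ) (op ⟨⊥⟩) f) =
      divB (geomDivisorFunctor Γ) (geomUnitsFunctor Γ) (geomDivNatTrans Γ) (op A.base) (Γ.mapB σ₀ f) :=
    pullGp_divB (DivB := geomDivNatTrans Γ) σ₀ f
  refine PreFrobenioid.Birat.untr_isFrobeniusCompact_of_invariant (geomFrobenioid_isFrobenioid Γ) _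
    (divB (geomDivisorFunctor Γ) (geomUnitsFunctor Γ) (geomDivNatTrans Γ) (op A.base) (Γ.mapB σ₀ f)) ?_ ?_ ?_
  · exact (ModelFrobenioid.mem_biratSubgroup_iff_exists_divB (geomUnitsFunctor_isGroupLike Γ)
      (fun X => Γ.isDivisorial_phi X) (geomFrobenioid_isFrobenioid Γ) A _).mpr ⟨_, rfl⟩
  · exact Γ.divPhi_pow_ne_one A.base (Γ.mapB σ₀ f) Q hfQ
  · intro g
    -- `τ^* σ₀^* = (σ₀ ∘ τ)^* = σ₀^*`, `Hom(Spec L, Spec K)` being a singleton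
    have key : pullGp (geomDivisorFunctor Γ) (PreFrobenioid.Birat.gpBase g.inv ≫ σ₀)
          (divB (geomDivisorFunctor Γ) (geomUnitsFunctor Γ) (geomDivNatTrans Γ) (op ⟨⊥⟩) f) =
        pullGp (geomDivisorFunctor Γ) σ₀
          (divB (geomDivisorFunctor Γ) (geomUnitsFunctor Γ) (geomDivNatTrans Γ) (op ⟨⊥⟩) f) :=
      congrArg (fun τ => pullGp (geomDivisorFunctor Γ) τ
          (divB (geomDivisorFunctor Γ) (geomUnitsFunctor Γ) (geomDivNatTrans Γ) (op ⟨⊥⟩) f))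
        (@Subsingleton.elim _ (FinSubextCat.subsingleton_hom_bot (K := K) (Kt := Kt) _) _ σ₀)
    rw [← hd]
    exact (pullGp_comp (Φ := geomDivisorFunctor Γ) (PreFrobenioid.Birat.gpBase g.inv) σ₀ _).symm.trans key

/-- … hence literally for EVERY object `Y` of THE `(C_{K̃/K}^un-tr)^birat` (each is such an image, `A := Y.as.obj`).
[cite: MochizukiFrdI2008, Thm. 6.2 (iii) p.112] -/
theorem geomFrobenioid_untrBirat_isFrobeniusCompact_all
    (hsupport : ∀ (X : FinSubextCat K Kt) (P : Γ.primeDiv X), ∃ f : Γ.B X, (Multiplicative.toAdd (Γ.div X f)) P ≠ 0)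
    (Y : (PreFrobenioid.rsParams (geomFrobenioid_isFrobenioid Γ) fun a 𝔭 => PrimarySupp a 𝔭).BU.Birat) :
    (PreFrobenioid.rsParams (geomFrobenioid_isFrobenioid Γ) fun a 𝔭 => PrimarySupp a 𝔭).BU.ops.IsFrobeniusCompact
      Y :=
  geomFrobenioid_untrBirat_isFrobeniusCompact Γ hsupport (Y : (geomFrobenioidOps Γ).Untr).as.obj

end GeomAll

end Literature.AlgebraicGeometry.Frobenioids

end
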